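import Literature.MathematicalPhysics.QuantumLattice.InfVolFermionStateLatticeMapPullback
import Literature.MathematicalPhysics.QuantumLattice.InfVolFermionStateProduct
import Literature.MathematicalPhysics.QuantumLattice.FermionBoxSubadditivity
import Literature.MathematicalPhysics.QuantumLattice.LayeredLatticeEnergyTransport
import HarnessLib

/-!
# Region entropies of infinite-volume lattice-fermion states: marginals as fermionic partial traces,
# translation invariance of box entropies, layer slices of `ℤ^{d+1}` and LAYER SUBADDITIVITY
# `S(ω|_{[0,ℓ)^{d+1}}) ≤ ℓ · S((ω ∘ Γ_layer)|_{[0,ℓ)^d})`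

Topic `Literature/MathematicalPhysics/QuantumLattice` (family `hubbard`, crew hubbard-fast S2 «T > 0 / interlayer coupling»).
The `T > 0` variational calculus of the tree (`TIVariationalPressure`: `P(β,Ψ) = sup_ω [s̄(ω) − βe_Ψ(ω)]`, `s̄` the upper box-entropy
density) needs, for DIMENSION RAISING (layered crystals `ℤ^{d+1} = ℤ × ℤ^d`), the entropy bookkeeping of pull-backs of states along
lattice injections (layer marginals) and translations. This file proves:

* §1 **Marginals are fermionic partial traces.** `tr_{Λ ⊆ Λ'} ρ_{Λ'}(ω) = ρ_Λ(ω)` (`fermionPartialTrace_incl_rdm`; hence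
  `regionEntropy (ω.rdm Λ') Λ = S(ω.rdm Λ)`, the dictionary with `FermionBoxSubadditivity` / `FermionEntropyChainRule`); the density
  matrices of the pulled-back state `ω ∘ Γ_f` and of the translate `ω ∘ τ_v` are partial traces along bijections (`rdm_mapAct`,
  `rdm_shift`), so **`S((ω ∘ Γ_f)|_Λ) = S(ω|_{f(Λ)})`**, **`S((ω ∘ τ_v)|_Λ) = S(ω|_{Λ+v})`**, and the box entropies of a
  TRANSLATION-INVARIANT state are translation invariant (`IsTranslationInvariant.vonNeumannEntropy_rdm_shiftSet`); `S(ω|_∅) = 0`;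
  `ω ∘ Γ_{f+v} = (ω ∘ τ_v) ∘ Γ_f` (`mapAct_eq_mapAct_shift`), so invariant states have the same pull-back along `f` and `f + v`.
* §2 **Layers of `ℤ^{d+1}`** (the layer tiling `(k, y) ↦ (k, y)` of `LayeredLatticeEnergyTransport`): the layers are
  lexicographically ordered (`toLex_layerTiling_lt` — the layer index is the most significant Jordan–Wigner coordinate); the layers met by
  the box `[0,ℓ)^{d+1}` and its layer parts (`tileClasses_layerTiling_halfOpenBox_subset`, `tileLoc_layerTiling_halfOpenBox`); the layer
  slices `{k} × [0,ℓ)^d = mapSet (tileLeg (layerTiling d) k) [0,ℓ)^d` (membership, inclusion, disjointness, cardinality); for a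
  translation-invariant state of `ℤ^{d+1}` the pull-back along ANY layer is the layer-`0` marginal
  (`IsTranslationInvariant.mapAct_tileLeg_layerTiling`), every slice carries the box entropy of the marginal
  (`IsTranslationInvariant.vonNeumannEntropy_rdm_layerSlice`), and **LAYER SUBADDITIVITY**
  `S(ω|_{[0,ℓ)^{d+1}}) ≤ ℓ · S((ω ∘ Γ_layer)|_{[0,ℓ)^d})` (`IsTranslationInvariant.vonNeumannEntropy_rdm_halfOpenBox_le_layers`;
  subadditivity of the entropy of even states over the `ℓ` disjoint slices, `FermionBoxSubadditivity`).

Everything is PROVED; no definition, no named fact, no number. Companion: `FermionProductStateRegionEntropy` (entropy of Araki–Moriya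
product states / stacks, the matching LOWER bound for dimension raising).

## Mathlib / tree search

REUSED: `InfVolFermionState.rdm`, `trace_rdm_mul`, `trace_rdm`, `rdm_isHermitian`, `rdm_posSemidef`, `compatible`, `shift`, `shift_expect`,
`IsTranslationInvariant`, `adjDensity` (`InfVolFermionState`, `InfVolFermionStateProduct`); `mapAct`, `mapAct_expect`, `mapSet`,
`PolySite.mapEmb` (`InfVolFermionStateLatticeMapPullback`); `fermionPartialTrace`, `eq_fermionPartialTrace_of_forall_trace_mul`,
`fermionPartialTrace_refl`, `vonNeumannEntropy_fermionPartialTrace_eq_of_range_eq` (`FermionPartialTrace`); `regionEntropy`,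
`vonNeumannEntropy_le_sum_regionEntropy_add` (`FermionEntropyChainRule`, `FermionBoxSubadditivity`); `IsEven.parityAut_rdm`,
`IsTranslationInvariant.isEven`; `layerTiling`, `layerHom`, `tileLeg_layerTiling(_zero/_add)`, `tileClass_layerTiling`
(`LayeredLatticeEnergyTransport`); `vonNeumannEntropy_nonneg`, `vonNeumannEntropy_le_log_card`; Mathlib `Pi.Lex`, `Fin.cons`,
`Finset.Ico`, `Int.card_Ico`. `lean search 'rdm_mapAct|rdm_shift|regionEntropy_rdm|vonNeumannEntropy_rdm_shiftSet'` (2026-08-28): nothing.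

## References

* H. Araki, H. Moriya, Rev. Math. Phys. 15 (2003) 93–198, §3.1 (entropy of restrictions), §4.1 Def. 4.3/4.5 (translations,
  invariant states), §10 (entropy of invariant states, subadditivity). [cite: ArakiMoriya2003, Theorem 3.8 and §10]
* O. Bratteli, D. W. Robinson, *OAQSM 2* (1997), Prop. 6.2.38 / Thm. 6.2.40 (mean entropy of invariant states). [cite: BratteliRobinsonII1997, Thm. 6.2.40]
* M. A. Nielsen, I. L. Chuang, *QCQI* (2010), §11.3.4 (subadditivity), Thm. 11.8. [cite: NielsenChuang2010, §11.3.4]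
-/

noncomputable section

namespace Literature.MathematicalPhysics.QuantumLattice

open Matrix Finset HubbardWave0 Literature.Probability.LatticeModels ThermodynamicLimit
open scoped ComplexOrder BigOperators
open Literature.InformationTheory.Entropy (vonNeumannEntropy vonNeumannEntropy_nonneg)

/-! ### §1 Marginals as fermionic partial traces; translation invariance of region entropies -/

namespace InfVolFermionState

variable {d d' : ℕ}

/-- **The density matrix of a sub-region is the fermionic partial trace of the density matrix of the region**:
`tr_{Λ ⊆ Λ'} ρ_{Λ'} = ρ_Λ` (compatibility of the local states with isotony, read on density matrices).
[cite: ArakiMoriya2003, §4.1 Def. 4.5] -/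
theorem fermionPartialTrace_incl_rdm (ω : InfVolFermionState d) {Λ Λ' : Finset (Site d)} (h : Λ ⊆ Λ') :
    fermionPartialTrace (PolySite.incl h) (ω.rdm Λ') = ω.rdm Λ := by
  symm
  refine eq_fermionPartialTrace_of_forall_trace_mul _ _ fun A => ?_
  rw [Matrix.trace_mul_comm, trace_rdm_mul, Matrix.trace_mul_comm, trace_rdm_mul, ω.compatible h]

/-- **Dictionary with `regionEntropy`**: the region entropy of `Λ ⊆ Λ'` computed from `ρ_{Λ'}(ω)` is `S(ρ_Λ(ω))`.
[cite: ArakiMoriya2003, §3.1] -/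
theorem regionEntropy_rdm (ω : InfVolFermionState d) {Λ Λ' : Finset (Site d)} (h : Λ ⊆ Λ') :
    regionEntropy (ω.rdm Λ') Λ = vonNeumannEntropy (ω.rdm Λ) := by
  rw [regionEntropy_of_subset _ h, fermionPartialTrace_incl_rdm]

/-- Equal regions carry density matrices of equal entropy (transport across a `Finset` equality). [cite: ArakiMoriya2003, §3.1] -/
theorem vonNeumannEntropy_rdm_congr (ω : InfVolFermionState d) {Λ Λ' : Finset (Site d)} (h : Λ = Λ') :
    vonNeumannEntropy (ω.rdm Λ) = vonNeumannEntropy (ω.rdm Λ') := by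
  subst h
  rfl

/-- **The density matrix of the EMPTY region has zero entropy** (a `1 × 1` density matrix). [cite: NielsenChuang2010, Theorem 11.8 (2) p.513] -/
theorem vonNeumannEntropy_rdm_empty (ω : InfVolFermionState d) :
    vonNeumannEntropy (ω.rdm (∅ : Finset (Site d))) = 0 := by
  refine le_antisymm ?_ (vonNeumannEntropy_nonneg (ω.rdm_posSemidef _) (ω.trace_rdm _))
  have h := vonNeumannEntropy_le_log_card (ω.rdm_posSemidef (∅ : Finset (Site d))) (ω.trace_rdm _)
  have hc : #(lexSites (∅ : Finset (Site d))) = 0 := by rw [lexSites, Finset.card_map, Finset.card_empty]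
  rw [Fintype.card_finset, Fintype.card_lex, Fintype.card_prod, Fintype.card_fin, Fintype.card_coe, hc,
    zero_mul, pow_zero, Nat.cast_one, Real.log_one] at h
  exact h

/-- **The density matrices of the pulled-back state `ω ∘ Γ_f` are partial traces along the site map**:
`ρ_Λ(ω ∘ Γ_f) = tr_{mapEmb f} ρ_{f(Λ)}(ω)`. [cite: BratteliRobinsonI1987, §4.3.1] -/
theorem rdm_mapAct (f : Site d → Site d') (hf : Function.Injective f) (ω : InfVolFermionState d') (Λ : Finset (Site d)) :
    (ω.mapAct f hf).rdm Λ = fermionPartialTrace (PolySite.mapEmb f hf Λ) (ω.rdm (mapSet f Λ)) := by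
  refine eq_fermionPartialTrace_of_forall_trace_mul _ _ fun A => ?_
  rw [Matrix.trace_mul_comm, trace_rdm_mul, mapAct_expect, ← trace_rdm_mul, Matrix.trace_mul_comm]

/-- The site map of a region onto its image is onto. [cite: ArakiMoriya2003, §4.1 Def. 4.1 (2)] -/
theorem range_mapEmb (f : Site d → Site d') (hf : Function.Injective f) (Λ : Finset (Site d)) :
    Set.range (PolySite.mapEmb f hf Λ) = Set.univ := by
  refine Set.eq_univ_of_forall fun y => ?_
  obtain ⟨x, hx, hxy⟩ := (mem_mapSet_iff f).1 (PolySite.ofLex_mem y)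
  refine ⟨PolySite.pt x hx, Subtype.ext ?_⟩
  rw [PolySite.coe_mapEmb_eq, PolySite.ofLex_coe_pt, hxy, toLex_ofLex]

/-- **`S((ω ∘ Γ_f)|_Λ) = S(ω|_{f(Λ)})`**: pulling back along an injective site map does not change region entropies.
[cite: ArakiMoriya2003, §3.1 and §10] -/
theorem vonNeumannEntropy_rdm_mapAct (f : Site d → Site d') (hf : Function.Injective f) (ω : InfVolFermionState d')
    (Λ : Finset (Site d)) :
    vonNeumannEntropy ((ω.mapAct f hf).rdm Λ) = vonNeumannEntropy (ω.rdm (mapSet f Λ)) := by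
  rw [rdm_mapAct, vonNeumannEntropy_fermionPartialTrace_eq_of_range_eq (PolySite.mapEmb f hf Λ)
      (Equiv.refl (PolySite (mapSet f Λ))).toEmbedding
      (by rw [range_mapEmb, Equiv.coe_toEmbedding, Equiv.range_eq_univ]) (ω.rdm_isHermitian _)]
  exact congrArg vonNeumannEntropy (fermionPartialTrace_refl _)

/-- **The density matrices of the translate `ω ∘ τ_v` are partial traces along the translation**:
`ρ_Λ(ω ∘ τ_v) = tr_{τ_v} ρ_{Λ+v}(ω)`. [cite: ArakiMoriya2003, §4.1 Def. 4.3 and eq. (4.11)] -/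
theorem rdm_shift (v : Site d) (ω : InfVolFermionState d) (Λ : Finset (Site d)) :
    (ω.shift v).rdm Λ = fermionPartialTrace (PolySite.shiftEmb v Λ) (ω.rdm (shiftSet v Λ)) := by
  refine eq_fermionPartialTrace_of_forall_trace_mul _ _ fun A => ?_
  rw [Matrix.trace_mul_comm, trace_rdm_mul, shift_expect, ← trace_rdm_mul, Matrix.trace_mul_comm]

/-- The translation of a region onto its translate is onto. [cite: ArakiMoriya2003, §4.1 Def. 4.3] -/
theorem range_shiftEmb (v : Site d) (Λ : Finset (Site d)) :
    Set.range (PolySite.shiftEmb v Λ) = Set.univ := by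
  refine Set.eq_univ_of_forall fun y => ?_
  have hy : ofLex y.1 - v ∈ Λ := mem_shiftSet.1 (PolySite.ofLex_mem y)
  refine ⟨PolySite.pt (ofLex y.1 - v) hy, Subtype.ext ?_⟩
  rw [PolySite.coe_shiftEmb, PolySite.ofLex_coe_pt, sub_add_cancel, toLex_ofLex]

/-- **`S((ω ∘ τ_v)|_Λ) = S(ω|_{Λ+v})`.** [cite: ArakiMoriya2003, §3.1 and §10] -/
theorem vonNeumannEntropy_rdm_shift (v : Site d) (ω : InfVolFermionState d) (Λ : Finset (Site d)) :
    vonNeumannEntropy ((ω.shift v).rdm Λ) = vonNeumannEntropy (ω.rdm (shiftSet v Λ)) := by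
  rw [rdm_shift, vonNeumannEntropy_fermionPartialTrace_eq_of_range_eq (PolySite.shiftEmb v Λ)
      (Equiv.refl (PolySite (shiftSet v Λ))).toEmbedding
      (by rw [range_shiftEmb, Equiv.coe_toEmbedding, Equiv.range_eq_univ]) (ω.rdm_isHermitian _)]
  exact congrArg vonNeumannEntropy (fermionPartialTrace_refl _)

/-- **Box entropies of a translation-invariant state are translation invariant**: `S(ω|_{Λ+v}) = S(ω|_Λ)`.
[cite: ArakiMoriya2003, §10 (translation invariance of the entropy of invariant states)] -/
theorem IsTranslationInvariant.vonNeumannEntropy_rdm_shiftSet {ω : InfVolFermionState d} (hω : ω.IsTranslationInvariant)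
    (v : Site d) (Λ : Finset (Site d)) :
    vonNeumannEntropy (ω.rdm (shiftSet v Λ)) = vonNeumannEntropy (ω.rdm Λ) := by
  rw [← vonNeumannEntropy_rdm_shift, hω v]

/-- **Translating the target of a pull-back is pulling back the translate**: for `g = f + v` pointwise,
`ω ∘ Γ_g = (ω ∘ τ_v) ∘ Γ_f`. [cite: BratteliRobinsonI1987, §4.3.1] -/
theorem mapAct_eq_mapAct_shift (ω : InfVolFermionState d') {f g : Site d → Site d'} (hf : Function.Injective f)
    (hg : Function.Injective g) (v : Site d') (hfg : ∀ y, g y = f y + v) :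
    ω.mapAct g hg = (ω.shift v).mapAct f hf := by
  refine InfVolFermionState.ext fun X => LinearMap.ext fun A => ?_
  have h12 : mapSet g X ⊆ shiftSet v (mapSet f X) := by
    intro x hx
    obtain ⟨y, hy, rfl⟩ := (mem_mapSet_iff g).1 hx
    rw [mem_shiftSet, hfg y, add_sub_cancel_right]
    exact mem_mapSet_of_mem f hy
  rw [mapAct_expect, mapAct_expect, shift_expect, fermionEmbed_fermionEmbed, ← ω.compatible h12,
    fermionEmbed_fermionEmbed]
  congr 1
  refine congrFun (congrArg _ (fermionEmbed_congr fun y => Subtype.ext ?_)) A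
  show toLex (g (ofLex y.1)) = toLex (f (ofLex y.1) + v)
  rw [hfg]

/-- For a translation-invariant state the pull-backs along `f` and along `f + v` coincide.
[cite: BratteliRobinsonI1987, §4.3.1 (G-invariant states)] -/
theorem IsTranslationInvariant.mapAct_eq_of_add {ω : InfVolFermionState d'} (hω : ω.IsTranslationInvariant)
    {f g : Site d → Site d'} (hf : Function.Injective f) (hg : Function.Injective g) (v : Site d')
    (hfg : ∀ y, g y = f y + v) : ω.mapAct g hg = ω.mapAct f hf := by
  rw [mapAct_eq_mapAct_shift ω hf hg v hfg, hω v]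

/-- Transport of an adjusted density matrix across a `Finset` equality of its region. [cite: ArakiMoriya2003, §11.1 Lemma 11.1] -/
theorem fermionEmbed_incl_adjDensity_of_eq (ν : InfVolFermionState d') {X X' : Finset (Site d')} (h : X ⊆ X')
    (hXX' : X = X') : fermionEmbed (PolySite.incl h) (ν.adjDensity X) = ν.adjDensity X' := by
  subst hXX'
  rw [PolySite.incl_rfl, fermionEmbed_refl_apply]

end InfVolFermionState

/-! ### §2 Layers of `ℤ^{d+1}`: lexicographic order, box parts, slices, layer subadditivity -/

section Layers

variable {d : ℕ}

/-- The layer tiling sends `(k, y)` to `Fin.cons k y`. [cite: ArakiMoriya2003, §11.1] -/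
theorem layerTiling_apply (k : ℤ) (y : Site d) : layerTiling d (k, y) = Fin.cons k y := rfl

/-- **The layers are lexicographically ordered**: `k < j ⇒ (k, y) < (j, y')` in the Jordan–Wigner order of `ℤ^{d+1}` (the layer
index is the most significant coordinate). [cite: ArakiMoriya2003, §4.1 (the order of `ℤ^ν`)] -/
theorem toLex_layerTiling_lt ⦃k j : ℤ⦄ (hkj : k < j) (y y' : Site d) :
    toLex (layerTiling d (k, y)) < toLex (layerTiling d (j, y')) := by
  show Pi.Lex (· < ·) (· < ·) (layerTiling d (k, y)) (layerTiling d (j, y'))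
  refine ⟨0, fun i hi => absurd hi (Fin.not_lt_zero i), ?_⟩
  show (Fin.cons k y : Site (d + 1)) 0 < (Fin.cons j y' : Site (d + 1)) 0
  rwa [Fin.cons_zero, Fin.cons_zero]


namespace InfVolFermionState

/-- The layers met by the box `[0,ℓ)^{d+1}` are among `0, …, ℓ − 1`. [cite: ArakiMoriya2003, §11.1 (the regions `I_i ∩ Λ`)] -/
theorem tileClasses_layerTiling_halfOpenBox_subset (ℓ : ℕ) :
    tileClasses (layerTiling d) (halfOpenBox (d + 1) ℓ) ⊆ Finset.Ico (0 : ℤ) ℓ := by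
  intro k hk
  obtain ⟨x, hx, rfl⟩ := Finset.mem_image.1 hk
  rw [tileClass_layerTiling, Finset.mem_Ico]
  exact (mem_halfOpenBox.1 hx) 0

/-- **The layer-`k` part of the box `[0,ℓ)^{d+1}` is the box `[0,ℓ)^d`** for `0 ≤ k < ℓ`. [cite: ArakiMoriya2003, §11.1 (the regions `I_i ∩ Λ`)] -/
theorem tileLoc_layerTiling_halfOpenBox {ℓ : ℕ} {k : ℤ} (hk : k ∈ Finset.Ico (0 : ℤ) ℓ) :
    tileLoc (layerTiling d) (halfOpenBox (d + 1) ℓ) k = halfOpenBox d ℓ := by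
  rw [Finset.mem_Ico] at hk
  ext y
  rw [mem_tileLoc, tileLeg_layerTiling, mem_halfOpenBox, mem_halfOpenBox, Fin.forall_fin_succ, Fin.cons_zero]
  simp only [Fin.cons_succ]
  exact ⟨fun h => h.2, fun h => ⟨hk, h⟩⟩

/-! #### Layer slices of the box and layer subadditivity for translation-invariant states -/

/-- Membership in the **layer-`k` slice `{k} × [0,ℓ)^d` of `ℤ^{d+1}`** (the image of the box `[0,ℓ)^d` under the `k`-th leg).
[cite: ArakiMoriya2003, §11.1 (the regions `I_i ∩ Λ`)] -/
theorem mem_layerSlice {ℓ : ℕ} {k : ℤ} {x : Site (d + 1)} :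
    x ∈ mapSet (tileLeg (layerTiling d) k) (halfOpenBox d ℓ) ↔ x 0 = k ∧ Fin.tail x ∈ halfOpenBox d ℓ := by
  rw [mem_mapSet_iff]
  constructor
  · rintro ⟨y, hy, rfl⟩
    rw [tileLeg_layerTiling]
    exact ⟨Fin.cons_zero _ _, by rwa [Fin.tail_cons]⟩
  · rintro ⟨hx0, hxt⟩
    refine ⟨Fin.tail x, hxt, ?_⟩
    rw [tileLeg_layerTiling, ← hx0, Fin.cons_self_tail]

/-- The slices `0 ≤ k < ℓ` lie in the box. [cite: ArakiMoriya2003, §11.1] -/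
theorem layerSlice_subset_halfOpenBox {ℓ : ℕ} {k : ℤ} (hk : k ∈ Finset.Ico (0 : ℤ) ℓ) :
    mapSet (tileLeg (layerTiling d) k) (halfOpenBox d ℓ) ⊆ halfOpenBox (d + 1) ℓ := by
  intro x hx
  rw [mem_layerSlice] at hx
  rw [Finset.mem_Ico] at hk
  rw [mem_halfOpenBox, Fin.forall_fin_succ, hx.1]
  exact ⟨hk, fun i => (mem_halfOpenBox.1 hx.2) i⟩

/-- Distinct slices are disjoint. [cite: ArakiMoriya2003, §11.1 (mutually disjoint regions)] -/
theorem disjoint_layerSlice {ℓ : ℕ} {k j : ℤ} (hkj : k ≠ j) :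
    Disjoint (mapSet (tileLeg (layerTiling d) k) (halfOpenBox d ℓ)) (mapSet (tileLeg (layerTiling d) j) (halfOpenBox d ℓ)) :=
  Finset.disjoint_left.2 fun _ hk hj => hkj ((mem_layerSlice.1 hk).1.symm.trans (mem_layerSlice.1 hj).1)

/-- A slice has `ℓ^d` sites. [cite: FriedliVelenik2017, §3.2] -/
theorem card_layerSlice (ℓ : ℕ) (k : ℤ) : (mapSet (tileLeg (layerTiling d) k) (halfOpenBox d ℓ)).card = ℓ ^ d := by
  rw [mapSet, Finset.card_image_of_injective _ (tileLeg_injective _ k), card_halfOpenBox]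

/-- **For a translation-invariant state of `ℤ^{d+1}` every layer pull-back is the layer-`0` marginal**:
`ω ∘ Γ_{layer k} = ω ∘ Γ_{layer 0}`. [cite: BratteliRobinsonI1987, §4.3.1 (G-invariant states)] -/
theorem IsTranslationInvariant.mapAct_tileLeg_layerTiling {ω : InfVolFermionState (d + 1)} (hω : ω.IsTranslationInvariant)
    (k : ℤ) :
    ω.mapAct (tileLeg (layerTiling d) k) (tileLeg_injective _ k) = ω.mapAct (layerHom d) (layerHom_injective d) := by
  refine hω.mapAct_eq_of_add (layerHom_injective d) (tileLeg_injective _ k) (Fin.cons k (0 : Site d)) fun y => ?_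
  rw [← tileLeg_layerTiling_zero, tileLeg_layerTiling_add]
  simp

/-- **Slice entropies of a translation-invariant state**: `S(ω|_{slice k}) = S((ω ∘ Γ_layer)|_{[0,ℓ)^d})` for every layer `k`.
[cite: ArakiMoriya2003, §3.1 and §10] -/
theorem IsTranslationInvariant.vonNeumannEntropy_rdm_layerSlice {ω : InfVolFermionState (d + 1)}
    (hω : ω.IsTranslationInvariant) (ℓ : ℕ) (k : ℤ) :
    vonNeumannEntropy (ω.rdm (mapSet (tileLeg (layerTiling d) k) (halfOpenBox d ℓ))) =
      vonNeumannEntropy ((ω.mapAct (layerHom d) (layerHom_injective d)).rdm (halfOpenBox d ℓ)) := by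
  rw [← hω.mapAct_tileLeg_layerTiling k, vonNeumannEntropy_rdm_mapAct]

/-- **LAYER SUBADDITIVITY**: for a translation-invariant state `ω` of `ℤ^{d+1}` (`d ≥ 1`, so that `ω` is even) and every `ℓ`,
`S(ω|_{[0,ℓ)^{d+1}}) ≤ ℓ · S((ω ∘ Γ_layer)|_{[0,ℓ)^d})` — subadditivity of the entropy over the `ℓ` layer slices of the box, each
slice carrying the box entropy of the layer marginal. [cite: ArakiMoriya2003, Theorem 3.8 and §10] [cite: BratteliRobinsonII1997, Thm. 6.2.40] -/
theorem IsTranslationInvariant.vonNeumannEntropy_rdm_halfOpenBox_le_layers {ω : InfVolFermionState (d + 1)}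
    (hω : ω.IsTranslationInvariant) (ℓ : ℕ) :
    vonNeumannEntropy (ω.rdm (halfOpenBox (d + 1) ℓ)) ≤
      ℓ * vonNeumannEntropy ((ω.mapAct (layerHom d) (layerHom_injective d)).rdm (halfOpenBox d ℓ)) := by
  have hev : parityAut (ω.rdm (halfOpenBox (d + 1) ℓ)) = ω.rdm (halfOpenBox (d + 1) ℓ) :=
    (hω.isEven (Nat.succ_pos d)).parityAut_rdm _
  have h := vonNeumannEntropy_le_sum_regionEntropy_add (Finset.Ico (0 : ℤ) ℓ)
    (fun k => mapSet (tileLeg (layerTiling d) k) (halfOpenBox d ℓ))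
    (fun k hk => layerSlice_subset_halfOpenBox hk) (fun k _ j _ hkj => disjoint_layerSlice hkj)
    (ω.rdm_posSemidef _) (ω.trace_rdm _) hev
  have hsum : ∑ k ∈ Finset.Ico (0 : ℤ) ℓ,
      regionEntropy (ω.rdm (halfOpenBox (d + 1) ℓ)) (mapSet (tileLeg (layerTiling d) k) (halfOpenBox d ℓ)) =
      ℓ * vonNeumannEntropy ((ω.mapAct (layerHom d) (layerHom_injective d)).rdm (halfOpenBox d ℓ)) := by
    rw [Finset.sum_congr rfl fun k hk => by
      rw [ω.regionEntropy_rdm (layerSlice_subset_halfOpenBox hk), hω.vonNeumannEntropy_rdm_layerSlice ℓ k],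
      Finset.sum_const, Int.card_Ico, nsmul_eq_mul]
    simp
  have hcard : ((halfOpenBox (d + 1) ℓ).card : ℝ) -
      ∑ k ∈ Finset.Ico (0 : ℤ) ℓ, ((mapSet (tileLeg (layerTiling d) k) (halfOpenBox d ℓ)).card : ℝ) = 0 := by
    rw [Finset.sum_congr rfl fun k _ => by rw [card_layerSlice], Finset.sum_const, Int.card_Ico, card_halfOpenBox, nsmul_eq_mul]
    push_cast
    simp [pow_succ, mul_comm]
  rw [hsum, hcard, zero_mul, add_zero] at h
  exact h

end InfVolFermionState

end Layers

end Literature.MathematicalPhysics.QuantumLattice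

end
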